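import Summits.HodgeConjecture.CorCM.RationalExteriorAlgebra
import Summits.HodgeConjecture.CorCM.KunnethDegreeOne
import Literature.AlgebraicGeometry.Motives.AbelianVarietyProduct
import HarnessLib

/-!
# COR-CM model layer, row M22 `Fact_algDuality`, kernel K-b (part 2): Künneth independence in bidegree `(1,1)`
# and uniqueness of the polar family

Cell `pub-hodgecm2` (COR-CM), seat `b16`, row M22 K-b.  Companion of `CorCM/Model/PoincareClass.lean`: there, for a basis
`b` of `H¹(A(ℂ); ℚ)` and `θ ∈ H²(A(ℂ); ℚ)`, a POLAR FAMILY `y : Fin n → H¹(A(ℂ); ℚ)` with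
`m^*θ - pr₁^*θ - pr₂^*θ = Σ_a pr₁^* b_a ∪ pr₂^* y_a` is shown to exist (`exists_polClass_eq_sum`).  HERE it is shown to be
UNIQUE (`polarFamily_unique`), so that any construction of it (e.g. K-a's contraction of `θ ∈ ⋀² H¹` against the dual
basis, template `Motives.WeilCohomology.polBasis`) agrees with any other.  The tool is the **Künneth independence in
bidegree `(1,1)`**: for linearly independent families `v, v'` of degree-one classes on `A`, the classes
`pr₁^* v_a ∪ pr₂^* v'_{a'} ∈ H²((A × A)(ℂ); ℚ)` are linearly independent (`linearIndependent_cup_pull_fst_pull_snd`) — from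
Künneth in degree one (`pull_fst_add_pull_snd_injective`: `pr₁^* H¹ ⊕ pr₂^* H¹ ↪ H¹(A × A)`) and the rational exterior-algebra
structure of `H•((A × A)(ℂ); ℚ)` (`linearIndependent_cupPowOne_of_linearIndependent` for the abelian variety `A × A`:
wedges of a linearly independent family of degree-one classes are linearly independent).  Definition-free.

## References
* [MumfordAV1970] D. Mumford, *Abelian Varieties* (1970), §1 (3)–(4) (Künneth formula and `H•(X) = ⋀• H¹(X)`).
* [LangeBirkenhake1992] H. Lange, Ch. Birkenhake, *Complex Abelian Varieties* (1992), Lemma 1.1.17, Cor. 1.1.19.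
* [HatcherAT2002] A. Hatcher, *Algebraic Topology* (2002), §3.2 Thm. 3.15 (Künneth), Example 3.16.
-/

noncomputable section

open CategoryTheory MonoidalCategory CartesianMonoidalCategory
open Literature.AlgebraicTopology.SingularHomology
open Literature.AlgebraicGeometry.Motives (SchemeOver ComplexPoints IsSmoothProjective bettiCohomology AbelianVariety)
open Literature.AlgebraicGeometry.HodgeTheory

namespace Summit.HodgeConjecture.CorCM.Model

section KunnethOneOne

variable (A : AbelianVariety ℂ)

/-- **Künneth in degree one, family form**: for linearly independent families `v, v'` in `H¹(A(ℂ); ℚ)`, the combined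
family `(pr₁^* v_a)_a ⊔ (pr₂^* v'_{a'})_{a'}` is linearly independent in `H¹((A × A)(ℂ); ℚ)`
(`pr₁^* ⊕ pr₂^* : H¹(A) ⊕ H¹(A) → H¹(A × A)` is injective, the cell's `pull_fst_add_pull_snd_injective`).
[cite: HatcherAT2002, §3.2 Thm. 3.15] [cite: MumfordAV1970, §1 (3)] -/
theorem linearIndependent_sumElim_pull_fst_pull_snd {ι ι' : Type*} {v : ι → bettiCohomology A.X 1}
    {v' : ι' → bettiCohomology A.X 1} (hv : LinearIndependent ℚ v) (hv' : LinearIndependent ℚ v') :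
    LinearIndependent ℚ (Sum.elim (fun a ↦ BettiUniverse.pull (fst A.X A.X) 1 (v a))
      (fun a ↦ BettiUniverse.pull (snd A.X A.X) 1 (v' a))) := by
  have hA : IsSmoothProjective A.dim A.X := AbelianVariety.isSmoothProjective_holds (A := A)
  have h := (linearIndependent_inl_union_inr' hv hv').map'
    ((BettiUniverse.pull (fst A.X A.X) 1).coprod (BettiUniverse.pull (snd A.X A.X) 1))
    (LinearMap.ker_eq_bot.2 (pull_fst_add_pull_snd_injective hA hA))
  have hfun : Sum.elim (fun a ↦ BettiUniverse.pull (fst A.X A.X) 1 (v a)) (fun a ↦ BettiUniverse.pull (snd A.X A.X) 1 (v' a)) =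
      ⇑((BettiUniverse.pull (fst A.X A.X) 1).coprod (BettiUniverse.pull (snd A.X A.X) 1)) ∘
        Sum.elim (⇑(LinearMap.inl ℚ _ _) ∘ v) (⇑(LinearMap.inr ℚ _ _) ∘ v') := by
    funext a
    rcases a with a | a <;> simp
  rw [hfun]
  exact h

/-- The same family indexed by `Fin (n + m)` through `Fin.append`. [cite: HatcherAT2002, §3.2 Thm. 3.15] -/
theorem linearIndependent_append_pull_fst_pull_snd {n m : ℕ} {v : Fin n → bettiCohomology A.X 1}
    {v' : Fin m → bettiCohomology A.X 1} (hv : LinearIndependent ℚ v) (hv' : LinearIndependent ℚ v') :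
    LinearIndependent ℚ (Fin.append (fun a ↦ BettiUniverse.pull (fst A.X A.X) 1 (v a))
      (fun a ↦ BettiUniverse.pull (snd A.X A.X) 1 (v' a))) := by
  rw [← linearIndependent_equiv finSumFinEquiv]
  have hfun : Fin.append (fun a ↦ BettiUniverse.pull (fst A.X A.X) 1 (v a))
      (fun a ↦ BettiUniverse.pull (snd A.X A.X) 1 (v' a)) ∘ ⇑finSumFinEquiv =
      Sum.elim (fun a ↦ BettiUniverse.pull (fst A.X A.X) 1 (v a)) (fun a ↦ BettiUniverse.pull (snd A.X A.X) 1 (v' a)) := by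
    funext a
    rcases a with a | a
    · simp only [Function.comp_apply, finSumFinEquiv_apply_left, Fin.append_left, Sum.elim_inl]
    · simp only [Function.comp_apply, finSumFinEquiv_apply_right, Fin.append_right, Sum.elim_inr]
  rw [hfun]
  exact linearIndependent_sumElim_pull_fst_pull_snd A hv hv'

/-- The order embedding `Fin 2 ↪o Fin (n + m)`, `0 ↦ a` (left block), `1 ↦ n + a'` (right block). [folklore] -/
theorem strictMono_vecCons_castAdd_natAdd {n m : ℕ} (a : Fin n) (a' : Fin m) :
    StrictMono ![Fin.castAdd m a, Fin.natAdd n a'] := by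
  rw [Fin.strictMono_iff_lt_succ]
  intro i
  rw [Subsingleton.elim i 0]
  show Fin.castAdd m a < Fin.natAdd n a'
  rw [Fin.lt_def, Fin.val_castAdd, Fin.val_natAdd]
  omega

/-- **Künneth independence in bidegree `(1,1)`**: for linearly independent families `v : Fin n → H¹(A(ℂ); ℚ)`,
`v' : Fin m → H¹(A(ℂ); ℚ)`, the classes `pr₁^* v_a ∪ pr₂^* v'_{a'}`, `(a, a') ∈ Fin n × Fin m`, are linearly independent in
`H²((A × A)(ℂ); ℚ)`.  Proof: they are among the wedges `w_s`, `|s| = 2`, of the linearly independent family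
`w = (pr₁^* v) ⊔ (pr₂^* v')` of degree-one classes on the abelian variety `A × A`, and those are linearly independent
(`H•((A × A)(ℂ); ℚ) = ⋀• H¹`, the cell's `linearIndependent_cupPowOne_of_linearIndependent`). [cite: MumfordAV1970, §1 (3)–(4)] [cite: LangeBirkenhake1992, Lemma 1.1.17 and Cor. 1.1.19] -/
theorem linearIndependent_cup_pull_fst_pull_snd {n m : ℕ} {v : Fin n → bettiCohomology A.X 1}
    {v' : Fin m → bettiCohomology A.X 1} (hv : LinearIndependent ℚ v) (hv' : LinearIndependent ℚ v') :
    LinearIndependent ℚ (fun aa' : Fin n × Fin m ↦ BettiUniverse.cup (A.X ⊗ A.X) 1 1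
      (BettiUniverse.pull (fst A.X A.X) 1 (v aa'.1)) (BettiUniverse.pull (snd A.X A.X) 1 (v' aa'.2))) := by
  have hw := linearIndependent_append_pull_fst_pull_snd A hv hv'
  have hLI := linearIndependent_cupPowOne_of_linearIndependent (A.prod A) 2 hw
  -- the injection `(a, a') ↦ {a, n + a'}` into the `2`-subsets of `Fin (n + m)`
  let e : Fin n × Fin m → (Fin 2 ↪o Fin (n + m)) := fun aa' ↦
    OrderEmbedding.ofStrictMono _ (strictMono_vecCons_castAdd_natAdd aa'.1 aa'.2)
  have he : Function.Injective e := by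
    intro aa' cc' h
    have h0 := congrArg (fun f : Fin 2 ↪o Fin (n + m) ↦ (f 0 : ℕ)) h
    have h1 := congrArg (fun f : Fin 2 ↪o Fin (n + m) ↦ (f 1 : ℕ)) h
    simp only [e, OrderEmbedding.coe_ofStrictMono, Matrix.cons_val_zero, Matrix.cons_val_one,
      Fin.val_castAdd, Fin.val_natAdd] at h0 h1
    exact Prod.ext (Fin.ext h0) (Fin.ext (by omega))
  have h2 := hLI.comp (fun aa' ↦ Set.powersetCard.ofFinEmbEquiv (e aa'))
    (Set.powersetCard.ofFinEmbEquiv.injective.comp he)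
  have key : (fun aa' : Fin n × Fin m ↦ BettiUniverse.cup (A.X ⊗ A.X) 1 1
      (BettiUniverse.pull (fst A.X A.X) 1 (v aa'.1)) (BettiUniverse.pull (snd A.X A.X) 1 (v' aa'.2))) =
      (fun s : Set.powersetCard (Fin (n + m)) 2 ↦ wedgeToCup ℚ (ComplexPoints (A.X ⊗ A.X)) 2
        (exteriorPower.ιMulti_family ℚ 2 (Fin.append (fun a ↦ BettiUniverse.pull (fst A.X A.X) 1 (v a))
          (fun a ↦ BettiUniverse.pull (snd A.X A.X) 1 (v' a))) s)) ∘
        fun aa' ↦ Set.powersetCard.ofFinEmbEquiv (e aa') := by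
    funext aa'
    simp only [Function.comp_apply]
    rw [exteriorPower.ιMulti_family, Equiv.symm_apply_apply, wedgeToCup_ιMulti, cupPowOne_succ, cupPowOne_one]
    simp only [Function.comp_apply, Fin.tail, Fin.succ_zero_eq_one, e, OrderEmbedding.coe_ofStrictMono,
      Matrix.cons_val_zero, Matrix.cons_val_one, Fin.append_left, Fin.append_right]
  rw [key]
  exact h2

/-- **Uniqueness of the polar family**: for a basis `b` of `H¹(A(ℂ); ℚ)` indexed by `Fin n`, a family
`y : Fin n → H¹(A(ℂ); ℚ)` is determined by the class `Σ_a pr₁^* b_a ∪ pr₂^* y_a ∈ H²((A × A)(ℂ); ℚ)`.  In particular the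
polar family of `θ` along `b` (`PoincareClass.exists_polClass_eq_sum`: `m^*θ - pr₁^*θ - pr₂^*θ = Σ_a pr₁^* b_a ∪ pr₂^* y_a`)
is unique, whence equal to any other construction of it (template: `Motives.WeilCohomology.polBasis`,
`coprod_one_one_eq_sum`). [cite: MumfordAV1970, §1 (3)–(4)] -/
theorem polarFamily_unique {n : ℕ} (b : Module.Basis (Fin n) ℚ (bettiCohomology A.X 1))
    {y y' : Fin n → bettiCohomology A.X 1}
    (h : ∑ a, BettiUniverse.cup (A.X ⊗ A.X) 1 1 (BettiUniverse.pull (fst A.X A.X) 1 (b a))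
        (BettiUniverse.pull (snd A.X A.X) 1 (y a)) =
      ∑ a, BettiUniverse.cup (A.X ⊗ A.X) 1 1 (BettiUniverse.pull (fst A.X A.X) 1 (b a))
        (BettiUniverse.pull (snd A.X A.X) 1 (y' a))) :
    y = y' := by
  have hLI := linearIndependent_cup_pull_fst_pull_snd A b.linearIndependent b.linearIndependent
  -- `Σ_a pr₁^* b_a ∪ pr₂^* (y_a - y'_a) = 0`, expanded along `b` in the second slot
  have h0 : ∑ a, BettiUniverse.cup (A.X ⊗ A.X) 1 1 (BettiUniverse.pull (fst A.X A.X) 1 (b a))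
      (BettiUniverse.pull (snd A.X A.X) 1 (y a - y' a)) = 0 := by
    simp only [map_sub, Finset.sum_sub_distrib, h, sub_self]
  have hexp : ∀ a, BettiUniverse.cup (A.X ⊗ A.X) 1 1 (BettiUniverse.pull (fst A.X A.X) 1 (b a))
      (BettiUniverse.pull (snd A.X A.X) 1 (y a - y' a)) =
      ∑ a', b.repr (y a - y' a) a' • BettiUniverse.cup (A.X ⊗ A.X) 1 1 (BettiUniverse.pull (fst A.X A.X) 1 (b a))
        (BettiUniverse.pull (snd A.X A.X) 1 (b a')) := by
    intro a
    conv_lhs => rw [← b.sum_repr (y a - y' a)]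
    rw [map_sum, map_sum]
    refine Finset.sum_congr rfl fun a' _ ↦ ?_
    rw [map_smul, map_smul]
  rw [Finset.sum_congr rfl fun a _ ↦ hexp a,
    ← Fintype.sum_prod_type' (fun a a' ↦ b.repr (y a - y' a) a' •
      BettiUniverse.cup (A.X ⊗ A.X) 1 1 (BettiUniverse.pull (fst A.X A.X) 1 (b a))
        (BettiUniverse.pull (snd A.X A.X) 1 (b a')))] at h0
  have hc := Fintype.linearIndependent_iff.1 hLI (fun aa' ↦ b.repr (y aa'.1 - y' aa'.1) aa'.2) h0
  funext a
  rw [← sub_eq_zero, ← b.forall_coord_eq_zero_iff]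
  intro a'
  exact hc (a, a')

end KunnethOneOne

end Summit.HodgeConjecture.CorCM.Model

end
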